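import Summits.QuantumFields.YangMills.Theorems.BalabanUVNodesK1NodeOLadderRunwiseEdges
import Summits.QuantumFields.YangMills.Theorems.BalabanUVNodesK1NodeOLadderRunwiseSeparations

/-!
# K1⁷ — NODE O's LETTER LADDER IN THE RUN CURRENCY, III: the SLACK-UNIFORM no-shrink letter `L* := ∀ β₀ > 0, ∃ γ₀ > 0, no-(1+β₀)⁻¹-shrink on ]0, γ₀]` — the weakest MATCH-FREE floor letter

Cell `pub-ymgap`, WIDTH SEAT `pub-ymgap-dag-n24-w1` (gen 3; director-ym №197 ∕ HUMAN RULING D-0149).  `--kind proof --supports stmt-QuantumFields-20542 --as helper`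
(count-neutral).  Key of record: K1⁷ `Summit.QuantumFields.YangMills.Theses.BalabanUVNodes.StabilityBAtRecordR13SepCoPH` (skeleton v6 03f66ac9cc89391f, plan g82).  Sibling modules:
I `…K1NodeOLadderRunwiseEdges` (p610312: PS floor ⟹ no-shrink for EVERY slack on a shrunk level), II `…K1NodeOLadderRunwiseSeparations` (p611396: kernel strictness of every rung inside a
box; §0 there: the slack is CAPPED on N11's (2.6)–(2.9) road — strat-b14's recorded `B14FlowStep.SmallnessFor` has `β₀_le_one : β₀ ≤ 1` (needed by (2.7), `ineq27a`) and the
sufficient, NON-sharp `h29c : L·β₀ ≤ 1` (⇒ `β₀ ≤ 1/2`; the sharp third-member requirement is only `L·β₀·γ²β′ ≤ 1`, `third_member_29_sharp`, so for small `γ` every `β₀ ≤ 1` is printed-admissible)).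
[I] = [Balaban1987RG1] CMP **109** (1987): (0.20) p.256, Thm 2 p.259; [III] = [Balaban1988Convergent] CMP **119** (1988): (2.6)–(2.9) pp.255–256 («β₀ > 0 can be chosen arbitrarily small, if g
is sufficiently small»).

WHY.  On the (2.6) road (dag-n24-c 36H ∕ 37H, ym-nodeO-ideate P3 g52 n°89–n°91) the K1-side NODE-O letter at the witness is «no-(1+β₀)⁻¹-shrink along in-window (0.20)-runs» AT THE WORLD's
SLACK `w.β₀`, and node N11's family `h11` is read at the same `(βup, β₀)`; [III]'s printed regime CAPS the slack (`β₀ ≤ 1` sharp, `β₀ ≤ 1/2` under `SmallnessFor` as recorded — II §0) and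
lets it be «arbitrarily small», so a no-shrink letter with ONE slack (36H: `β₀ = 1`, the sharp cap itself) or an ∃-slack (n°90 ∕ 37H; useless to N11 if the witness slack exceeds the cap)
carries a floor-side MATCH against N11's admissible slack.  The letter that pays EVERY slack N11 may ask, with the level allowed to depend on the slack —
`L*(β) := ∀ β₀ > 0, ∃ γ₀ > 0, ∀ n gs, RGEqH n β gs → Step.InInterval γ₀ n gs → ∀ m < n′ ≤ n, gs m ≤ (1+β₀)·gs n′` — is therefore the weakest MATCH-FREE floor currency on that road.  This
module places `L*` on the kernel ladder: PS floor ⟹ `L*` (I, re-read here as `slackUniformNoShrink_of_psFloor`) ⟹ no-halving on some level (`exists_noHalving_of_slackUniformNoShrink`), and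
BOTH edges are STRICT inside the box `[−β′, 0]` for every radius `β′ > 0`: ★ `absBox_slackUniformNoShrink_not_psFloor` (new two-phase model whose band SHRINKS WITH THE INITIAL COUPLING,
`β_k := −β′` while `1/g_k² + β′ ≤ (1+g_0)/g_0²`, else `0`: on runs started below `γ₀ := min β₀ 1` the multiplicative drawdown is `≤ 1+g_0 ≤ (1+β₀)²`, while the additive drawdown `≈ 1/g_0` is
unbounded — so `L*` does NOT give the registered row (iv) ∕ 32H's PS floor for any `M` on any window) and `absBox_noHalvingEverywhere_not_slackUniform` (II (b₂) re-read: no-halving on every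
window, yet `L*` fails at slack `1/2`).  So, kernel-certified and inside K0's box: no-halving < `L*` < PS floor — `L*` asks NODE O for strictly less than the registered row (iv) and still serves
every slack; the registered row (iv) remains the strongest match-free currency in the tree.

HONEST FRAMING.  Hypothesis shapes, one implication re-read from module I and two explicit counter-models; nothing of Bałaban asserted, nothing about `Node00.betaOfRecord₁₃` proved or refuted
(which rung the true β of record satisfies is NODE O's unprinted content, [I] Thm 2 p.259 ∕ T09.F); `L*` is NOT a registered text (no re-cut asked or implied — a located currency note for the
planner); NO stub closed; K0⁷ ∕ K1⁷ OPEN; N24 COMPOSITE — no discharge, counts unmoved (typed 28∕28 · discharged 5∕27); one finite 𝕋⁴ programme at fixed `ε = L^{−K}`, Bałaban AS PRINTED;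
route R4 closes ONLY the CONDITIONAL finite-𝕋⁴ rung `BalabanLadder.UV` — the Yang–Mills mass gap (Clay) is NOT proved by any of this; nothing continuum ∕ ℝ⁴ ∕ OS.  Theorems only: no
`def`, no `instance`, no `sorry`, standard axioms; Theses-free (imports the two sibling modules, themselves over `Literature…FlowStep ∕ B14FlowStep` only).
-/

noncomputable section

namespace Summit.QuantumFields.YangMills.Theorems.K1NodeOLadderRunwiseSlackUniform

open Literature.MathematicalPhysics.QuantumFieldTheory.Balaban1983to89
open FlowStep (HBeta RGEqH prefixOf prefixOf_apply BetaLowerH BetaUpperH Box mem_box inv_sq_telescopeH)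
open Summit.QuantumFields.YangMills.Theorems.K1NodeOLadderRunwiseEdges (exists_noShrink_of_psFloor)
open Summit.QuantumFields.YangMills.Theorems.K1NodeOLadderRunwiseSeparations (absBox_noHalving_not_noShrinkHalf)

variable {β : HBeta}

/-! ## §1. `L*` on the ladder: below the PS floor, above no-halving-on-some-level -/

/-- **PS FLOOR ⟹ `L*`** (module I's `exists_noShrink_of_psFloor`, re-read with the slack universally quantified: ONE partial-sum floor on `]0, γ]` pays no-(1+β₀)⁻¹-shrink for EVERY slack
`β₀ > 0`, each on its own level `γ₀ ≤ γ`). [cite: Balaban1988Convergent, (2.6) p.255; Balaban1987RG1, (0.20) p.256 (elementary)] -/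
theorem slackUniformNoShrink_of_psFloor {M γ : ℝ} (hγ : 0 < γ)
    (h : ∀ (n : ℕ) (gs : ℕ → ℝ), RGEqH n β gs → Step.InInterval γ n gs → ∀ k, k ≤ n → -M ≤ ∑ j ∈ Finset.Ico k n, β j (prefixOf gs j)) :
    ∀ β₀ : ℝ, 0 < β₀ → ∃ γ₀ : ℝ, 0 < γ₀ ∧ γ₀ ≤ γ ∧
      ∀ (n : ℕ) (gs : ℕ → ℝ), RGEqH n β gs → Step.InInterval γ₀ n gs → ∀ m n', m < n' → n' ≤ n → gs m ≤ (1 + β₀) * gs n' :=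
  fun _ hβ₀ => exists_noShrink_of_psFloor hβ₀ hγ h

/-- **`L*` ⟹ NO-HALVING ON SOME LEVEL** (the slack `β₀ := 1`; conclusion in dag-n24-c 36H's `hnh` letter shape `gs m ≤ (1 + 1) * gs n'`). [cite: Balaban1988Convergent, (2.6) p.255 (bookkeeping)] -/
theorem exists_noHalving_of_slackUniformNoShrink
    (h : ∀ β₀ : ℝ, 0 < β₀ → ∃ γ₀ : ℝ, 0 < γ₀ ∧
      ∀ (n : ℕ) (gs : ℕ → ℝ), RGEqH n β gs → Step.InInterval γ₀ n gs → ∀ m n', m < n' → n' ≤ n → gs m ≤ (1 + β₀) * gs n') :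
    ∃ γ₀ : ℝ, 0 < γ₀ ∧ ∀ (n : ℕ) (gs : ℕ → ℝ), RGEqH n β gs → Step.InInterval γ₀ n gs → ∀ m n', m < n' → n' ≤ n → gs m ≤ (1 + 1) * gs n' :=
  h 1 one_pos

/-- **NO-HALVING ON EVERY WINDOW ⇏ `L*`, inside the box** (module II (b₂) re-read: its witness is no-halving on every window and no-⅔-shrink on none, so `L*` fails at the slack `1/2`).
[cite: Balaban1988Convergent, (2.6)–(2.9) pp.255–256; Balaban1987RG1, (0.20) p.256 (elementary model)] -/
theorem absBox_noHalvingEverywhere_not_slackUniform {β' : ℝ} (hβ' : 0 < β') : ∃ β : HBeta,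
    (∀ γ : ℝ, BetaLowerH (-β') γ β ∧ BetaUpperH 0 γ β) ∧
      (∀ (γ : ℝ) (n : ℕ) (gs : ℕ → ℝ), RGEqH n β gs → Step.InInterval γ n gs → ∀ m n', m < n' → n' ≤ n → gs m ≤ (1 + 1) * gs n') ∧
        ¬ ∀ β₀ : ℝ, 0 < β₀ → ∃ γ₀ : ℝ, 0 < γ₀ ∧
          ∀ (n : ℕ) (gs : ℕ → ℝ), RGEqH n β gs → Step.InInterval γ₀ n gs → ∀ m n', m < n' → n' ≤ n → gs m ≤ (1 + β₀) * gs n' := by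
  obtain ⟨β, hbox, hnh, hnot⟩ := absBox_noHalving_not_noShrinkHalf hβ'
  refine ⟨β, hbox, hnh, fun hL => ?_⟩
  obtain ⟨γ₀, hγ₀, h⟩ := hL (1 / 2) (by norm_num)
  exact hnot γ₀ hγ₀ h

/-! ## §2. `L*` ⇏ PS floor, inside the box: the two-phase model whose band shrinks with the initial coupling -/

section Model

/-- The explicit decreasing run `g_k := (A + β′k)^{−1/2}`: positivity. [folklore] -/
private theorem sqrtRun_pos {A β' : ℝ} (hA : 0 < A) (hβ' : 0 ≤ β') (k : ℕ) : 0 < (Real.sqrt (A + β' * k))⁻¹ :=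
  inv_pos.mpr (Real.sqrt_pos.mpr (by positivity))

/-- … it never exceeds its initial value `(√A)⁻¹`. [folklore] -/
private theorem sqrtRun_le {A β' : ℝ} (hA : 0 < A) (hβ' : 0 ≤ β') (k : ℕ) : (Real.sqrt (A + β' * k))⁻¹ ≤ (Real.sqrt A)⁻¹ :=
  inv_anti₀ (Real.sqrt_pos.mpr hA) (Real.sqrt_le_sqrt (by nlinarith [mul_nonneg hβ' (Nat.cast_nonneg k)]))

/-- … and `1/g_k² = A + β′k`. [folklore] -/
private theorem sqrtRun_inv_sq {A β' : ℝ} (hA : 0 < A) (hβ' : 0 ≤ β') (k : ℕ) : 1 / ((Real.sqrt (A + β' * k))⁻¹) ^ 2 = A + β' * k := by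
  rw [inv_pow, one_div, inv_inv, Real.sq_sqrt (by positivity)]

/-- `(√(1/x²))⁻¹ = x` for `x > 0`. [folklore] -/
private theorem sqrt_one_div_sq_inv {x : ℝ} (hx : 0 < x) : (Real.sqrt (1 / x ^ 2))⁻¹ = x := by
  rw [one_div, Real.sqrt_inv, inv_inv, Real.sqrt_sq hx.le]

/-- The shrinking-band model `β_k(v) := −β′` while `1/v_k² + β′ ≤ (1+v_0)/v_0²`, else `0`, lives in the box `[−β′, 0]`. [folklore] -/
private theorem shrinkBand_box {β' : ℝ} (hβ' : 0 ≤ β')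
    (hβ : ∀ (k : ℕ) (v : Fin (k + 1) → ℝ), β k v = if 1 / (v (Fin.last k)) ^ 2 + β' ≤ (1 + v 0) * (1 / (v 0) ^ 2) then -β' else 0) (γ : ℝ) :
    BetaLowerH (-β') γ β ∧ BetaUpperH 0 γ β := by
  refine ⟨fun k v _ => ?_, fun k v _ => ?_⟩ <;> rw [hβ k v] <;> split_ifs <;> linarith

/-- Its INVARIANT along every (0.20)-run with `g_0 ≥ 0`: `1/g_0² ≤ 1/g_k² ≤ (1+g_0)/g_0²` for `k ≤ n`. [folklore] -/
private theorem shrinkBand_invariant {β' : ℝ} (hβ' : 0 ≤ β')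
    (hβ : ∀ (k : ℕ) (v : Fin (k + 1) → ℝ), β k v = if 1 / (v (Fin.last k)) ^ 2 + β' ≤ (1 + v 0) * (1 / (v 0) ^ 2) then -β' else 0)
    {n : ℕ} {gs : ℕ → ℝ} (hrg : RGEqH n β gs) (h0 : 0 ≤ gs 0) :
    ∀ k, k ≤ n → 1 / (gs 0) ^ 2 ≤ 1 / (gs k) ^ 2 ∧ 1 / (gs k) ^ 2 ≤ (1 + gs 0) * (1 / (gs 0) ^ 2) := by
  intro k
  induction k with
  | zero =>
    intro _
    exact ⟨le_rfl, le_mul_of_one_le_left (one_div_nonneg.mpr (sq_nonneg _)) (by linarith)⟩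
  | succ k ih =>
    intro hk
    obtain ⟨ihlo, ihhi⟩ := ih (Nat.le_of_succ_le hk)
    have hstep := hrg k (Nat.lt_of_succ_le hk)
    rw [hβ k] at hstep
    simp only [prefixOf_apply, Fin.val_last, Fin.val_zero] at hstep
    split_ifs at hstep with hcond
    · constructor <;> linarith
    · constructor <;> linarith

/-- The shrinking-band model satisfies `L*`: for every slack `β₀ > 0` it is no-(1+β₀)⁻¹-shrink on `]0, min β₀ 1]` (there `1 + g_0 ≤ 1 + β₀ ≤ (1+β₀)²`). [folklore] -/
private theorem shrinkBand_slackUniform {β' : ℝ} (hβ' : 0 ≤ β')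
    (hβ : ∀ (k : ℕ) (v : Fin (k + 1) → ℝ), β k v = if 1 / (v (Fin.last k)) ^ 2 + β' ≤ (1 + v 0) * (1 / (v 0) ^ 2) then -β' else 0) :
    ∀ β₀ : ℝ, 0 < β₀ → ∃ γ₀ : ℝ, 0 < γ₀ ∧
      ∀ (n : ℕ) (gs : ℕ → ℝ), RGEqH n β gs → Step.InInterval γ₀ n gs → ∀ m n', m < n' → n' ≤ n → gs m ≤ (1 + β₀) * gs n' := by
  intro β₀ hβ₀
  refine ⟨min β₀ 1, lt_min hβ₀ one_pos, fun n gs hrg hI m n' hmn hn' => ?_⟩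
  have hm : 0 < gs m := (hI m (hmn.le.trans hn')).1
  have hn : 0 < gs n' := (hI n' hn').1
  have h0 : 0 < gs 0 := (hI 0 (Nat.zero_le _)).1
  have h0β : gs 0 ≤ β₀ := (hI 0 (Nat.zero_le _)).2.trans (min_le_left _ _)
  obtain ⟨hmlo, -⟩ := shrinkBand_invariant hβ' hβ hrg h0.le m (hmn.le.trans hn')
  obtain ⟨-, hnhi⟩ := shrinkBand_invariant hβ' hβ hrg h0.le n' hn'
  have hband : 1 + gs 0 ≤ (1 + β₀) ^ 2 := by nlinarith
  have key : 1 / (gs n') ^ 2 ≤ (1 + β₀) ^ 2 * (1 / (gs m) ^ 2) :=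
    calc 1 / (gs n') ^ 2 ≤ (1 + gs 0) * (1 / (gs 0) ^ 2) := hnhi
      _ ≤ (1 + gs 0) * (1 / (gs m) ^ 2) := mul_le_mul_of_nonneg_left hmlo (by linarith)
      _ ≤ (1 + β₀) ^ 2 * (1 / (gs m) ^ 2) := mul_le_mul_of_nonneg_right hband (by positivity)
  have hm2 : 0 < (gs m) ^ 2 := by positivity
  have hn2 : 0 < (gs n') ^ 2 := by positivity
  have hsq : (gs m) ^ 2 ≤ ((1 + β₀) * gs n') ^ 2 := by
    rw [div_le_iff₀ hn2] at key
    have e : (1 + β₀) ^ 2 * (1 / (gs m) ^ 2) * (gs n') ^ 2 = (1 + β₀) ^ 2 * (gs n') ^ 2 / (gs m) ^ 2 := by ring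
    rw [e, le_div_iff₀ hm2] at key
    rw [mul_pow]
    linarith
  exact (pow_le_pow_iff_left₀ hm.le (by positivity) two_ne_zero).1 hsq

/-- The shrinking-band model ADMITS the explicit decreasing run `g_k = (1/x² + β′k)^{−1/2}`, `k ≤ n`, in `]0, x]` whenever `n·β′ ≤ x·(1/x²)` (the whole run is in the negative phase).
[folklore] -/
private theorem shrinkBand_run {β' : ℝ} (hβ' : 0 ≤ β')
    (hβ : ∀ (k : ℕ) (v : Fin (k + 1) → ℝ), β k v = if 1 / (v (Fin.last k)) ^ 2 + β' ≤ (1 + v 0) * (1 / (v 0) ^ 2) then -β' else 0)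
    {x : ℝ} (hx : 0 < x) {n : ℕ} (hn : (n : ℝ) * β' ≤ x * (1 / x ^ 2)) :
    RGEqH n β (fun k => (Real.sqrt (1 / x ^ 2 + β' * k))⁻¹) ∧ Step.InInterval x n (fun k => (Real.sqrt (1 / x ^ 2 + β' * k))⁻¹) := by
  have hA : 0 < 1 / x ^ 2 := by positivity
  have hg0 : (Real.sqrt (1 / x ^ 2 + β' * ((0 : ℕ) : ℝ)))⁻¹ = x := by
    simp only [Nat.cast_zero, mul_zero, add_zero]; exact sqrt_one_div_sq_inv hx
  refine ⟨fun k hk => ?_, fun k _ => ⟨sqrtRun_pos hA hβ' k, (sqrtRun_le hA hβ' k).trans (sqrt_one_div_sq_inv hx).le⟩⟩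
  have hk1 : ((k : ℝ) + 1) * β' ≤ (n : ℝ) * β' := mul_le_mul_of_nonneg_right (by exact_mod_cast hk) hβ'
  have hcond : 1 / (prefixOf (fun k : ℕ => (Real.sqrt (1 / x ^ 2 + β' * k))⁻¹) k (Fin.last k)) ^ 2 + β' ≤
      (1 + prefixOf (fun k : ℕ => (Real.sqrt (1 / x ^ 2 + β' * k))⁻¹) k 0) *
        (1 / (prefixOf (fun k : ℕ => (Real.sqrt (1 / x ^ 2 + β' * k))⁻¹) k 0) ^ 2) := by
    simp only [prefixOf_apply, Fin.val_last, Fin.val_zero]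
    rw [sqrtRun_inv_sq hA hβ' k, sqrtRun_inv_sq hA hβ' 0, hg0]
    simp only [Nat.cast_zero, mul_zero, add_zero]
    linarith
  rw [hβ k, if_pos hcond]
  show 1 / ((Real.sqrt (1 / x ^ 2 + β' * (k : ℕ)))⁻¹) ^ 2 = 1 / ((Real.sqrt (1 / x ^ 2 + β' * ((k + 1 : ℕ) : ℝ)))⁻¹) ^ 2 + -β'
  rw [sqrtRun_inv_sq hA hβ' k, sqrtRun_inv_sq hA hβ' (k + 1)]
  push_cast; ring

end Model

/-- **★ `L*` ⇏ PS FLOOR, INSIDE THE BOX**: for every radius `β′ > 0` the shrinking-band family lies in `[−β′, 0]`, satisfies `L*` (for every slack `β₀ > 0` it is no-(1+β₀)⁻¹-shrink on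
`]0, min β₀ 1]`), and satisfies the run-wise PS floor (32H's `hps` ∕ K1⁷ v6 row (iv)) for NO `M` on NO window (the run from `g_0 = x → 0⁺` stays in the negative phase for `⌊1/(xβ′)⌋` steps:
`−∑_{[0,n)} β = nβ′ > 1/x − β′`).  So the slack-uniform letter asks NODE O for STRICTLY LESS than the registered row (iv), while (module I) row (iv) pays it.
[cite: Balaban1988Convergent, (2.6) p.255 («β₀ > 0 can be chosen arbitrarily small»); Balaban1987RG1, (0.20) p.256, Thm 2 p.259 (elementary model)] -/
theorem absBox_slackUniformNoShrink_not_psFloor {β' : ℝ} (hβ' : 0 < β') : ∃ β : HBeta,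
    (∀ γ : ℝ, BetaLowerH (-β') γ β ∧ BetaUpperH 0 γ β) ∧
      (∀ β₀ : ℝ, 0 < β₀ → ∃ γ₀ : ℝ, 0 < γ₀ ∧
        ∀ (n : ℕ) (gs : ℕ → ℝ), RGEqH n β gs → Step.InInterval γ₀ n gs → ∀ m n', m < n' → n' ≤ n → gs m ≤ (1 + β₀) * gs n') ∧
        ∀ γ : ℝ, 0 < γ → ∀ M : ℝ,
          ¬ ∀ (n : ℕ) (gs : ℕ → ℝ), RGEqH n β gs → Step.InInterval γ n gs → ∀ k, k ≤ n → -M ≤ ∑ j ∈ Finset.Ico k n, β j (prefixOf gs j) := by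
  refine ⟨fun k v => if 1 / (v (Fin.last k)) ^ 2 + β' ≤ (1 + v 0) * (1 / (v 0) ^ 2) then -β' else 0,
    shrinkBand_box hβ'.le (fun _ _ => rfl), shrinkBand_slackUniform hβ'.le (fun _ _ => rfl), fun γ hγ M hps => ?_⟩
  -- the run from `x := min γ (1/(|M| + 2β′ + 1))`, so that `1/x ≥ |M| + 2β′ + 1`
  have hden : 0 < |M| + 2 * β' + 1 := by positivity
  set x : ℝ := min γ (1 / (|M| + 2 * β' + 1)) with hx_def
  have hx : 0 < x := lt_min hγ (by positivity)
  have hxγ : x ≤ γ := min_le_left _ _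
  have hxM : x ≤ 1 / (|M| + 2 * β' + 1) := min_le_right _ _
  have hA : 0 < 1 / x ^ 2 := by positivity
  have hxinv : |M| + 2 * β' + 1 ≤ 1 / x := by
    have : 1 / (1 / (|M| + 2 * β' + 1)) ≤ 1 / x := one_div_le_one_div_of_le hx hxM
    rwa [one_div_one_div] at this
  have hxA : x * (1 / x ^ 2) = 1 / x := by field_simp
  set n : ℕ := ⌊(1 / x) / β'⌋₊ with hn_def
  have hnle : (n : ℝ) * β' ≤ x * (1 / x ^ 2) := by
    have := Nat.floor_le (show 0 ≤ (1 / x) / β' by positivity)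
    rw [le_div_iff₀ hβ'] at this
    rw [hxA]; exact this
  have hngt : 1 / x - β' < (n : ℝ) * β' := by
    have := Nat.lt_floor_add_one ((1 / x) / β')
    rw [div_lt_iff₀ hβ'] at this
    simp only [hn_def]; linarith
  obtain ⟨hrg, hI⟩ := shrinkBand_run hβ'.le (fun _ _ => rfl) hx hnle
  have hIγ : Step.InInterval γ n (fun k => (Real.sqrt (1 / x ^ 2 + β' * k))⁻¹) := fun k hk => ⟨(hI k hk).1, (hI k hk).2.trans hxγ⟩
  have h := hps n _ hrg hIγ 0 (Nat.zero_le _)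
  have htel := inv_sq_telescopeH hrg (Nat.zero_le n) le_rfl
  rw [sqrtRun_inv_sq hA hβ'.le 0, sqrtRun_inv_sq hA hβ'.le n] at htel
  simp only [Nat.cast_zero, mul_zero, add_zero] at htel
  have hsum : ∑ j ∈ Finset.Ico 0 n, (fun (k : ℕ) (v : Fin (k + 1) → ℝ) => if 1 / (v (Fin.last k)) ^ 2 + β' ≤ (1 + v 0) * (1 / (v 0) ^ 2) then -β' else 0) j
      (prefixOf (fun k => (Real.sqrt (1 / x ^ 2 + β' * (k : ℝ)))⁻¹) j) = -((n : ℝ) * β') := by linarith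
  rw [hsum] at h
  have : M ≤ |M| := le_abs_self M
  linarith

end Summit.QuantumFields.YangMills.Theorems.K1NodeOLadderRunwiseSlackUniform

end
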